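import Summits.AtomisticToContinuum.Crystallization.Theses.GappedShellCensus
import Literature.Geometry.DiscreteGeometry.ConvexHullFacets
import Literature.Geometry.DiscreteGeometry.SphericalCodeHullEuler

/-!
# A bonded triangle is a facet of the radial hull

Worker lemma `stub_bondTriangleFacet` of the crux `GappedShellCensus.ShellTrichotomy`
(line `Sketch`, census half).

A pure hull lemma on a finite set `X` of unit vectors of `ℝ³` whose pairwise inner products are
all `≤ κ₂ := 2801/5202 ≈ 0.5384`: three distinct points `a, b, c ∈ X` with pairwise inner
products `≥ κ₁ := 2201/4802 ≈ 0.4584` form EXACTLY the tight set of a facet of `conv X`.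

Proof.  Write `x = ⟪a, b⟫`, `y = ⟪a, c⟫`, `z = ⟪b, c⟫ ∈ [κ₁, κ₂]` and let
`D = 1 + 2xyz − x² − y² − z²` be the Gram determinant of `a, b, c`; on the window
`D ≥ 1 + 2κ₁³ − 3κ₂² > 0.32` (`gram_pos`), so `a, b, c` are linearly independent
(`D = (orient3 a b c)²`, the tree's `orient3_sq_eq_gram`) and span `ℝ³`.  The exposing
functional is `c₀ := α a + β b + γ c` with the Cramer solution
`α = (1 − z)(1 + z − x − y)/D`, `β = (1 − y)(1 + y − x − z)/D`, `γ = (1 − x)(1 + x − y − z)/D`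
of `⟪c₀, a⟫ = ⟪c₀, b⟫ = ⟪c₀, c⟫ = 1` (`exists_cramer_coeffs`); all three are positive, and adding
the three equations gives `(α + β + γ)(1 + 2κ₁) ≤ 3`, whence for every other point `w ∈ X`:
`⟪c₀, w⟫ ≤ (α + β + γ) κ₂ ≤ 3κ₂/(1 + 2κ₁) < 0.85 < 1` (`sum_coeffs_lt`).  Hence `⟪c₀, ·⟫ ≤ 1` on
`X` with equality exactly on `{a, b, c}`.
-/

noncomputable section

namespace Summit.AtomisticToContinuum.Crystallization.Theorems

open scoped RealInnerProductSpace
open Literature.Geometry.DiscreteGeometry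

/-- The Gram determinant `1 + 2xyz − x² − y² − z²` of three unit vectors with pairwise inner
products in the window `[2201/4802, 2801/5202]` is positive (`≥ 1 + 2κ₁³ − 3κ₂² > 0.32`). -/
private theorem gram_pos {x y z : ℝ} (hx : 2201 / 4802 ≤ x) (hx' : x ≤ 2801 / 5202)
    (hy : 2201 / 4802 ≤ y) (hy' : y ≤ 2801 / 5202) (hz : 2201 / 4802 ≤ z)
    (hz' : z ≤ 2801 / 5202) : 0 < 1 + 2 * x * y * z - x ^ 2 - y ^ 2 - z ^ 2 := by
  have hxy : (2201 / 4802 : ℝ) * (2201 / 4802) ≤ x * y :=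
    mul_le_mul hx hy (by norm_num) (by linarith)
  have hxyz : (2201 / 4802 : ℝ) * (2201 / 4802) * (2201 / 4802) ≤ x * y * z :=
    mul_le_mul hxy hz (by norm_num) (mul_nonneg (by linarith) (by linarith))
  have hx2 : 0 ≤ (2801 / 5202 - x) * (2801 / 5202 + x) :=
    mul_nonneg (sub_nonneg.2 hx') (by linarith)
  have hy2 : 0 ≤ (2801 / 5202 - y) * (2801 / 5202 + y) :=
    mul_nonneg (sub_nonneg.2 hy') (by linarith)
  have hz2 : 0 ≤ (2801 / 5202 - z) * (2801 / 5202 + z) :=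
    mul_nonneg (sub_nonneg.2 hz') (by linarith)
  linarith

/-- **Cramer's rule for the unit-diagonal Gram system.**  For `x, y, z` in the window, the
system `α + βx + γy = 1`, `αx + β + γz = 1`, `αy + βz + γ = 1` has a solution with
`α, β, γ > 0`, namely `α = (1 − z)(1 + z − x − y)/D`, `β = (1 − y)(1 + y − x − z)/D`,
`γ = (1 − x)(1 + x − y − z)/D` with `D` the (positive) Gram determinant. -/
private theorem exists_cramer_coeffs {x y z : ℝ} (hx : 2201 / 4802 ≤ x) (hx' : x ≤ 2801 / 5202)
    (hy : 2201 / 4802 ≤ y) (hy' : y ≤ 2801 / 5202) (hz : 2201 / 4802 ≤ z)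
    (hz' : z ≤ 2801 / 5202) :
    ∃ α β γ : ℝ, 0 < α ∧ 0 < β ∧ 0 < γ ∧ α + β * x + γ * y = 1 ∧ α * x + β + γ * z = 1 ∧
      α * y + β * z + γ = 1 := by
  obtain ⟨D, hDdef, hD⟩ : ∃ D : ℝ, D = 1 + 2 * x * y * z - x ^ 2 - y ^ 2 - z ^ 2 ∧ 0 < D :=
    ⟨_, rfl, gram_pos hx hx' hy hy' hz hz'⟩
  have hDne : D ≠ 0 := hD.ne'
  refine ⟨(1 - z) * (1 + z - x - y) / D, (1 - y) * (1 + y - x - z) / D,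
    (1 - x) * (1 + x - y - z) / D, div_pos (mul_pos (by linarith) (by linarith)) hD,
    div_pos (mul_pos (by linarith) (by linarith)) hD,
    div_pos (mul_pos (by linarith) (by linarith)) hD, ?_, ?_, ?_⟩
  · field_simp
    rw [hDdef]
    ring
  · field_simp
    rw [hDdef]
    ring
  · field_simp
    rw [hDdef]
    ring

/-- Adding the three Cramer equations: `(α + β + γ)(1 + 2κ₁) ≤ 3`, so
`(α + β + γ) κ₂ ≤ 3κ₂/(1 + 2κ₁) < 0.85 < 1`. -/
private theorem sum_coeffs_lt {x y z α β γ : ℝ} (hx : 2201 / 4802 ≤ x) (hy : 2201 / 4802 ≤ y)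
    (hz : 2201 / 4802 ≤ z) (hα : 0 < α) (hβ : 0 < β) (hγ : 0 < γ)
    (e1 : α + β * x + γ * y = 1) (e2 : α * x + β + γ * z = 1) (e3 : α * y + β * z + γ = 1) :
    (α + β + γ) * (2801 / 5202) < 1 := by
  have h1 := mul_nonneg hα.le (sub_nonneg.2 hx)
  have h2 := mul_nonneg hα.le (sub_nonneg.2 hy)
  have h3 := mul_nonneg hβ.le (sub_nonneg.2 hx)
  have h4 := mul_nonneg hβ.le (sub_nonneg.2 hz)
  have h5 := mul_nonneg hγ.le (sub_nonneg.2 hy)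
  have h6 := mul_nonneg hγ.le (sub_nonneg.2 hz)
  linarith

/-- **A bonded triangle is a facet of the radial hull, with exactly three tight points** (pure
hull lemma on unit vectors of `ℝ³`): if all pairwise inner products of `X` are `≤ 2801/5202`
and `a, b, c ∈ X` are distinct with pairwise inner products `≥ 2201/4802`, then the functional
`c₀ = αa + βb + γc` given by Cramer's rule for `⟪c₀, a⟫ = ⟪c₀, b⟫ = ⟪c₀, c⟫ = 1` has
`α, β, γ > 0` and `(α + β + γ) · 2801/5202 < 1`, so `⟪c₀, w⟫ < 1` for every other `w ∈ X`;
and `a, b, c` span `ℝ³` (positive Gram determinant).  Hence `c₀ ∈ facetNormals X` with tight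
set exactly `{a, b, c}`. -/
theorem stub_bondTriangleFacet (X : Finset (EuclideanSpace ℝ (Fin 3))) (hX1 : ∀ y ∈ X, ‖y‖ = 1)
    (hsep : ∀ y ∈ X, ∀ y' ∈ X, y ≠ y' → ⟪y, y'⟫ ≤ 2801 / 5202)
    (a b c : EuclideanSpace ℝ (Fin 3)) (ha : a ∈ X) (hb : b ∈ X) (hc : c ∈ X)
    (hab : a ≠ b) (hbc : b ≠ c) (hac : a ≠ c)
    (kab : 2201 / 4802 ≤ ⟪a, b⟫) (kbc : 2201 / 4802 ≤ ⟪b, c⟫) (kac : 2201 / 4802 ≤ ⟪a, c⟫) :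
    ∃ c₀ ∈ facetNormals X, tightSet X c₀ = {a, b, c} := by
  classical
  -- the Gram matrix of `a, b, c`
  have xU : ⟪a, b⟫ ≤ 2801 / 5202 := hsep a ha b hb hab
  have yU : ⟪a, c⟫ ≤ 2801 / 5202 := hsep a ha c hc hac
  have zU : ⟪b, c⟫ ≤ 2801 / 5202 := hsep b hb c hc hbc
  have haa : ⟪a, a⟫ = 1 := by rw [real_inner_self_eq_norm_sq, hX1 a ha]; norm_num
  have hbb : ⟪b, b⟫ = 1 := by rw [real_inner_self_eq_norm_sq, hX1 b hb]; norm_num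
  have hcc : ⟪c, c⟫ = 1 := by rw [real_inner_self_eq_norm_sq, hX1 c hc]; norm_num
  have hba : ⟪b, a⟫ = ⟪a, b⟫ := real_inner_comm a b
  have hca : ⟪c, a⟫ = ⟪a, c⟫ := real_inner_comm a c
  have hcb : ⟪c, b⟫ = ⟪b, c⟫ := real_inner_comm b c
  -- the Cramer solution and the exposing functional
  obtain ⟨α, β, γ, hα, hβ, hγ, e1, e2, e3⟩ := exists_cramer_coeffs kab xU kac yU kbc zU
  have hS := sum_coeffs_lt kab kac kbc hα hβ hγ e1 e2 e3
  set c₀ : EuclideanSpace ℝ (Fin 3) := α • a + β • b + γ • c with hc₀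
  have hc₀i : ∀ w, ⟪c₀, w⟫ = α * ⟪a, w⟫ + β * ⟪b, w⟫ + γ * ⟪c, w⟫ := fun w => by
    rw [hc₀, inner_add_left, inner_add_left, real_inner_smul_left, real_inner_smul_left,
      real_inner_smul_left]
  have hc₀a : ⟪c₀, a⟫ = 1 := by rw [hc₀i, haa, hba, hca]; linarith
  have hc₀b : ⟪c₀, b⟫ = 1 := by rw [hc₀i, hbb, hcb]; linarith
  have hc₀c : ⟪c₀, c⟫ = 1 := by rw [hc₀i, hcc]; linarith
  -- every other point of `X` is strictly below the facet hyperplane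
  have hlt : ∀ w ∈ X, w ≠ a → w ≠ b → w ≠ c → ⟪c₀, w⟫ < 1 := by
    intro w hw hwa hwb hwc
    rw [hc₀i]
    have h1 : ⟪a, w⟫ ≤ 2801 / 5202 := hsep a ha w hw (Ne.symm hwa)
    have h2 : ⟪b, w⟫ ≤ 2801 / 5202 := hsep b hb w hw (Ne.symm hwb)
    have h3 : ⟪c, w⟫ ≤ 2801 / 5202 := hsep c hc w hw (Ne.symm hwc)
    have h1' := mul_le_mul_of_nonneg_left h1 hα.le
    have h2' := mul_le_mul_of_nonneg_left h2 hβ.le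
    have h3' := mul_le_mul_of_nonneg_left h3 hγ.le
    linarith
  have hle : ∀ w ∈ X, ⟪c₀, w⟫ ≤ 1 := by
    intro w hw
    by_cases hwa : w = a
    · rw [hwa, hc₀a]
    by_cases hwb : w = b
    · rw [hwb, hc₀b]
    by_cases hwc : w = c
    · rw [hwc, hc₀c]
    exact (hlt w hw hwa hwb hwc).le
  have htight : tightSet X c₀ = {a, b, c} := by
    ext w
    rw [mem_tightSet, Finset.mem_insert, Finset.mem_insert, Finset.mem_singleton]
    constructor
    · rintro ⟨hw, hw1⟩
      by_contra h'
      push Not at h'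
      exact (hlt w hw h'.1 h'.2.1 h'.2.2).ne hw1
    · rintro (rfl | rfl | rfl)
      · exact ⟨ha, hc₀a⟩
      · exact ⟨hb, hc₀b⟩
      · exact ⟨hc, hc₀c⟩
  -- `a, b, c` span `ℝ³`: the Gram determinant is `(orient3 a b c)² > 0`
  have hD := gram_pos kab xU kac yU kbc zU
  have hO : orient3 a b c ≠ 0 := by
    intro h0
    have hg := orient3_sq_eq_gram a b c
    rw [h0, haa, hbb, hcc, hca] at hg
    nlinarith [hg, hD]
  have hspan : Submodule.span ℝ (Set.range ![a, b, c]) = ⊤ :=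
    (linearIndependent_of_orient3_ne_zero hO).span_eq_top_of_card_eq_finrank (by simp)
  refine ⟨c₀, mem_facetNormals.2 ⟨hle, ?_⟩, htight⟩
  rw [htight, eq_top_iff, ← hspan, Submodule.span_le]
  rintro w ⟨i, rfl⟩
  apply Submodule.subset_span
  fin_cases i <;> simp

end Summit.AtomisticToContinuum.Crystallization.Theorems
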